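import Literature.MathematicalPhysics.KineticTheory.TaggedSphereCarleman
import HarnessLib

/-!
# A uniform mixed moment of the Carleman kernel of the hard-sphere linear Boltzmann operator
(towards BGSR (6.3): Bodineau–Gallagher–Saint-Raymond, Invent. Math. 203 (2016) =
arXiv:1305.3397v2, §6.1.2–6.1.3; a layer of the bottom-up proof of the named fact
`Literature.MathematicalPhysics.KineticTheory.bgsr_hydrodynamicLimit` of `TaggedSphereDiffusion`)

The last step of the velocity-only form of the hydrodynamic limit (6.3) (see
`TaggedSphereHydrodynamicModes`) converts an `L²(M_β dv)` estimate on the deviation `h` of the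
mode amplitude from its limit into an `M_β`-weighted uniform one, through one iteration of the
Duhamel formula: the gain term `(K⁺_β |h|)(v) = ∫ k_β(v, u) |h(v + u)| du` is split according to
the size of the density `ρ_v(u) = k_β(v, u) / M_β(v + u) = k_β(v + u, -u) / M_β(v)` (detailed
balance), `k_β |h| ≤ Λ M_β(v + u) |h(v + u)| + 2 Λ^{-θ} M_β(v)^{-θ} k_β(v, u) k_β(v + u, -u)^θ`
for `|h| ≤ 2`, so that everything rests on a bound, uniform in `v`, for the **mixed moment**
`I_θ(v) = ∫ k_β(v, u) k_β(v + u, -u)^θ du` of the Carleman kernel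
`k_β(v, u) = |u|^{2-d} p_β(|u| + ⟪v, u⟫/|u|)` of `TaggedSphereCarleman` (`p_β` the centred Gaussian
density of variance `β⁻¹` on `ℝ`). This file PROVES that bound (`exists_lintegral_carlemanKernel_mul_rpow_le`):
for `0 < θ` with `θ (d - 2) ≤ 1` there is `C = C(d, β, θ)` with `I_θ(v) ≤ C` for all `v`.

## The computation

* The reversed kernel is explicit: `k_β(v + u, -u) = |u|^{2-d} p_β(⟪v, u⟫/|u|)`
  (`carlemanKernel_add_neg`).
* In polar coordinates `u = r ν` (`lintegral_eq_lintegral_sphere_radial`, Mathlib's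
  `measurePreserving_homeomorphUnitSphereProd`, as in `TaggedSphereCarleman`) the integrand of
  `I_θ(v)` times the Jacobian `r^{d-1}` is `r^γ p_β(r + s) p_β(s)^θ`, `s = ⟪v, ν⟫`,
  `γ = 1 - θ(d - 2) ∈ [0, 1]`, and `r^γ ≤ 1 + r`.
* `∫₀^∞ (1 + r) p_β(r + s) dr ≤ ∫ (2 + |s| + t²) p_β(t) dt = 2 + |s| + β⁻¹` (translation
  invariance, `|t| ≤ 1 + t²`, unit mass and variance `β⁻¹` of `p_β`).
* `p_β(s)^θ (2 + β⁻¹ + |s|)` is bounded on `ℝ` (`exists_bound_gaussianPDFReal_rpow_mul`: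
  `|y| e^{-y²/2} ≤ 1`), and the surface measure of `S^{d-1}` is finite.

## References

* T. Bodineau, I. Gallagher, L. Saint-Raymond, *The Brownian motion as the limit of a
  deterministic system of hard-spheres*, Invent. Math. 203 (2016) 493–553 = arXiv:1305.3397v2,
  §6.1.2 (`L = a(v) - K`), §6.1.3.
* C. Cercignani, R. Illner, M. Pulvirenti, *The Mathematical Theory of Dilute Gases* (1994),
  §7.2 (Carleman representation and Grad's estimates for hard spheres).
-/

open MeasureTheory Metric Set Filter Topology ProbabilityTheory
open scoped InnerProductSpace ENNReal NNReal

namespace Literature.MathematicalPhysics.KineticTheory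

noncomputable section

variable {d : Type*} [Fintype d] {β : ℝ}

/-! ## Polar coordinates for `lintegral`s on `ℝ^d` -/

/-- **Polar coordinates** on `ℝ^d` for `ℝ≥0∞`-valued integrands:
`∫ H(u) du = ∫_{S^{d-1}} ∫₀^∞ r^{d-1} H(r ν) dr dν` (`sphereMeasure = volume.toSphere`,
Mathlib's `measurePreserving_homeomorphUnitSphereProd`). [folklore] -/
theorem lintegral_eq_lintegral_sphere_radial (hd : 2 ≤ Fintype.card d)
    {H : EuclideanSpace ℝ d → ℝ≥0∞} (hHm : Measurable H) :
    ∫⁻ u, H u = ∫⁻ ν, (∫⁻ r in Ioi (0 : ℝ), ENNReal.ofReal (r ^ (Fintype.card d - 1)) *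
      H (r • (ν : EuclideanSpace ℝ d))) ∂(sphereMeasure : Measure (sphere (0 : EuclideanSpace ℝ d) 1)) := by
  haveI : Nonempty d := Fintype.card_pos_iff.1 (by omega)
  have hdim : Module.finrank ℝ (EuclideanSpace ℝ d) = Fintype.card d := finrank_euclideanSpace
  set Gp : sphere (0 : EuclideanSpace ℝ d) 1 × Ioi (0 : ℝ) → ℝ≥0∞ := fun q =>
    H ((q.2 : ℝ) • (q.1 : EuclideanSpace ℝ d)) with hGp
  have hGpm : Measurable Gp :=
    hHm.comp ((continuous_subtype_val.comp continuous_snd).smul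
      (continuous_subtype_val.comp continuous_fst)).measurable
  calc ∫⁻ u, H u = ∫⁻ u in ({0}ᶜ : Set (EuclideanSpace ℝ d)), H u := by
        rw [restrict_compl_singleton]
    _ = ∫⁻ x : ({0}ᶜ : Set (EuclideanSpace ℝ d)), H x ∂(volume.comap Subtype.val) :=
        (lintegral_subtype_comap (measurableSet_singleton _).compl H).symm
    _ = ∫⁻ x : ({0}ᶜ : Set (EuclideanSpace ℝ d)),
          Gp (homeomorphUnitSphereProd (EuclideanSpace ℝ d) x) ∂(volume.comap Subtype.val) := by
        refine lintegral_congr fun x => ?_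
        simp only [hGp, homeomorphUnitSphereProd_apply_snd_coe, homeomorphUnitSphereProd_apply_fst_coe]
        have hx : ‖(x : EuclideanSpace ℝ d)‖ ≠ 0 := by
          rw [norm_ne_zero_iff]; exact x.2
        rw [smul_smul, mul_inv_cancel₀ hx, one_smul]
    _ = ∫⁻ q, Gp q ∂(sphereMeasure.prod (Measure.volumeIoiPow (Fintype.card d - 1))) := by
        have hmp := (volume : Measure (EuclideanSpace ℝ d)).measurePreserving_homeomorphUnitSphereProd
        rw [hdim] at hmp
        exact hmp.lintegral_comp hGpm
    _ = ∫⁻ ν, ∫⁻ r, Gp (ν, r) ∂(Measure.volumeIoiPow (Fintype.card d - 1)) ∂sphereMeasure :=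
        lintegral_prod _ hGpm.aemeasurable
    _ = _ := by
        refine lintegral_congr fun ν => ?_
        have hm1 : Measurable fun r : Ioi (0 : ℝ) => ENNReal.ofReal ((r : ℝ) ^ (Fintype.card d - 1)) :=
          (measurable_subtype_coe.pow_const _).ennreal_ofReal
        have hm2 : Measurable fun r : Ioi (0 : ℝ) => Gp (ν, r) :=
          hGpm.comp (measurable_const.prodMk measurable_id)
        have e1 : ∫⁻ r, Gp (ν, r) ∂(Measure.volumeIoiPow (Fintype.card d - 1)) =
            ∫⁻ r : Ioi (0 : ℝ), (fun s : ℝ => ENNReal.ofReal (s ^ (Fintype.card d - 1)) *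
              H (s • (ν : EuclideanSpace ℝ d))) (r : ℝ) ∂(volume.comap Subtype.val) :=
          lintegral_withDensity_eq_lintegral_mul _ hm1 hm2
        have e2 : ∫⁻ r : Ioi (0 : ℝ), (fun s : ℝ => ENNReal.ofReal (s ^ (Fintype.card d - 1)) *
              H (s • (ν : EuclideanSpace ℝ d))) (r : ℝ) ∂(volume.comap Subtype.val) =
            ∫⁻ s in Ioi (0 : ℝ), ENNReal.ofReal (s ^ (Fintype.card d - 1)) *
              H (s • (ν : EuclideanSpace ℝ d)) :=
          lintegral_subtype_comap (μ := (volume : Measure ℝ)) measurableSet_Ioi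
            (fun s : ℝ => ENNReal.ofReal (s ^ (Fintype.card d - 1)) * H (s • (ν : EuclideanSpace ℝ d)))
        rw [e1, e2]

/-! ## The reversed kernel -/

/-- **The reversed Carleman kernel is explicit**: `k_β(v + u, -u) = |u|^{2-d} p_β(⟪v, u⟫/|u|)`
(the jump `v + u ↦ v` only sees the component of `v` along `u`; `p_β` is even). [folklore] -/
theorem carlemanKernel_add_neg (β : ℝ) (v u : EuclideanSpace ℝ d) :
    carlemanKernel β (v + u) (-u) =
      (‖u‖ ^ (Fintype.card d - 2))⁻¹ * gaussianPDFReal 0 (β⁻¹).toNNReal (⟪v, u⟫_ℝ / ‖u‖) := by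
  by_cases hu : u = 0
  · subst hu
    simp [carlemanKernel]
  have hnu : ‖u‖ ≠ 0 := norm_ne_zero_iff.2 hu
  simp only [carlemanKernel, norm_neg, inner_neg_right, inner_add_left, real_inner_self_eq_norm_sq]
  rw [show ‖u‖ + -(⟪v, u⟫_ℝ + ‖u‖ ^ 2) / ‖u‖ = -(⟪v, u⟫_ℝ / ‖u‖) by field_simp; ring,
    gaussianPDFReal_zero_neg]

/-- The kernels along a ray `u = r ν`, `r > 0`, `|ν| = 1`: `k_β(v, rν) = r^{2-d} p_β(r + ⟪v, ν⟫)` and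
`k_β(v + rν, -rν) = r^{2-d} p_β(⟪v, ν⟫)`. [folklore] -/
theorem carlemanKernel_smul_sphere (β : ℝ) (v : EuclideanSpace ℝ d) (ν : sphere (0 : EuclideanSpace ℝ d) 1)
    {r : ℝ} (hr : 0 < r) :
    carlemanKernel β v (r • (ν : EuclideanSpace ℝ d)) =
        (r ^ (Fintype.card d - 2))⁻¹ * gaussianPDFReal 0 (β⁻¹).toNNReal (r + ⟪v, (ν : EuclideanSpace ℝ d)⟫_ℝ) ∧
      carlemanKernel β (v + r • (ν : EuclideanSpace ℝ d)) (-(r • (ν : EuclideanSpace ℝ d))) =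
        (r ^ (Fintype.card d - 2))⁻¹ * gaussianPDFReal 0 (β⁻¹).toNNReal ⟪v, (ν : EuclideanSpace ℝ d)⟫_ℝ := by
  have hν : ‖(ν : EuclideanSpace ℝ d)‖ = 1 := norm_eq_of_mem_sphere ν
  have hnorm : ‖r • (ν : EuclideanSpace ℝ d)‖ = r := by
    rw [norm_smul, Real.norm_eq_abs, abs_of_pos hr, hν, mul_one]
  have hinner : ⟪v, r • (ν : EuclideanSpace ℝ d)⟫_ℝ / ‖r • (ν : EuclideanSpace ℝ d)‖ =
      ⟪v, (ν : EuclideanSpace ℝ d)⟫_ℝ := by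
    rw [hnorm, inner_smul_right]
    field_simp
  constructor
  · rw [carlemanKernel, hinner, hnorm]
  · rw [carlemanKernel_add_neg, hinner, hnorm]

/-! ## One-dimensional Gaussian bounds -/

/-- The centred Gaussian density of variance `β⁻¹` in closed form. [folklore] -/
theorem gaussianPDFReal_inv_eq (hβ : 0 < β) (s : ℝ) :
    gaussianPDFReal 0 (β⁻¹).toNNReal s =
      (Real.sqrt (2 * Real.pi * β⁻¹))⁻¹ * Real.exp (-(β / 2) * s ^ 2) := by
  have hv : ((β⁻¹).toNNReal : ℝ) = β⁻¹ := Real.coe_toNNReal _ (inv_pos.2 hβ).le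
  simp only [gaussianPDFReal, hv, sub_zero]
  congr 1
  congr 1
  field_simp

/-- `p_β(s)^θ (A + |s|)` is bounded on `ℝ` for `θ > 0` (`y e^{-y²/2} ≤ 1`). [folklore] -/
theorem exists_bound_gaussianPDFReal_rpow_mul (hβ : 0 < β) {θ : ℝ} (hθ : 0 < θ) {A : ℝ} (hA : 0 ≤ A) :
    ∃ C : ℝ, 0 ≤ C ∧ ∀ s : ℝ, gaussianPDFReal 0 (β⁻¹).toNNReal s ^ θ * (A + |s|) ≤ C := by
  set c₀ : ℝ := (Real.sqrt (2 * Real.pi * β⁻¹))⁻¹ with hc₀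
  have hc₀0 : 0 ≤ c₀ := inv_nonneg.2 (Real.sqrt_nonneg _)
  refine ⟨c₀ ^ θ * (A + (Real.sqrt (θ * β))⁻¹), by positivity, fun s => ?_⟩
  have hexp0 : 0 < Real.exp (-(β / 2) * s ^ 2) := Real.exp_pos _
  rw [gaussianPDFReal_inv_eq hβ, Real.mul_rpow hc₀0 hexp0.le, mul_assoc]
  refine mul_le_mul_of_nonneg_left ?_ (Real.rpow_nonneg hc₀0 _)
  rw [← Real.exp_mul, mul_add]
  have h1 : Real.exp (-(β / 2) * s ^ 2 * θ) ≤ 1 := by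
    rw [Real.exp_le_one_iff]
    have : 0 ≤ β / 2 * s ^ 2 * θ := by positivity
    linarith
  have h2 : Real.exp (-(β / 2) * s ^ 2 * θ) * |s| ≤ (Real.sqrt (θ * β))⁻¹ := by
    have hκ : 0 < θ * β := mul_pos hθ hβ
    have hsp : 0 < Real.sqrt (θ * β) := Real.sqrt_pos.2 hκ
    set y : ℝ := Real.sqrt (θ * β) * |s| with hy
    have hy2 : -(β / 2) * s ^ 2 * θ = -(y ^ 2 / 2) := by
      rw [hy, mul_pow, Real.sq_sqrt hκ.le, sq_abs]; ring
    have hye : y ≤ Real.exp (y ^ 2 / 2) := by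
      nlinarith [Real.add_one_le_exp (y ^ 2 / 2), sq_nonneg (y - 1)]
    have e1 : |s| = y * (Real.sqrt (θ * β))⁻¹ := by
      rw [hy]; field_simp
    rw [hy2, e1, ← mul_assoc, Real.exp_neg]
    refine mul_le_of_le_one_left (inv_nonneg.2 hsp.le) ?_
    rw [inv_mul_le_iff₀ (Real.exp_pos _), mul_one]
    exact hye
  exact add_le_add (mul_le_of_le_one_left hA h1) h2

/-- **Shifted linear moment of the Gaussian over a half-line**:
`∫₀^∞ (1 + r) p_β(r + s) dr ≤ 2 + |s| + β⁻¹` (translate, `|t| ≤ 1 + t²`, unit mass and variance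
`β⁻¹`). [folklore] -/
theorem lintegral_Ioi_one_add_mul_gaussianPDFReal_le (hβ : 0 < β) (s : ℝ) :
    ∫⁻ r in Ioi (0 : ℝ), ENNReal.ofReal ((1 + r) * gaussianPDFReal 0 (β⁻¹).toNNReal (r + s)) ≤
      ENNReal.ofReal (2 + |s| + β⁻¹) := by
  set v : ℝ≥0 := (β⁻¹).toNNReal with hv
  have hv0 : v ≠ 0 := by
    rw [hv]; exact fun h => (inv_pos.2 hβ).ne' (Real.toNNReal_eq_zero.1 h |>.antisymm (inv_pos.2 hβ).le)
  have hvr : (v : ℝ) = β⁻¹ := Real.coe_toNNReal _ (inv_pos.2 hβ).le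
  set G : ℝ → ℝ := fun t => (2 + |s| + t ^ 2) * gaussianPDFReal 0 v t with hG
  have hG0 : ∀ t, 0 ≤ G t := fun t => mul_nonneg (by positivity) (gaussianPDFReal_nonneg _ _ _)
  -- pointwise: `(1 + r) p(r + s) ≤ G(r + s)` for `r ≥ 0`
  have hpt : ∀ r ∈ Ioi (0 : ℝ), ENNReal.ofReal ((1 + r) * gaussianPDFReal 0 v (r + s)) ≤
      ENNReal.ofReal (G (r + s)) := fun r hr => by
    refine ENNReal.ofReal_le_ofReal (mul_le_mul_of_nonneg_right ?_ (gaussianPDFReal_nonneg _ _ _))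
    have hr0 : 0 ≤ r := le_of_lt hr
    have h1 : r ≤ |r + s| + |s| := by
      have := abs_add_le (r + s) (-s); simp only [add_neg_cancel_right, abs_neg] at this
      rw [abs_of_nonneg hr0] at this; exact this
    have h2 : |r + s| ≤ 1 + (r + s) ^ 2 := by nlinarith [abs_nonneg (r + s), sq_abs (r + s)]
    linarith
  -- integrability and the value of `∫ G`
  have hGi : Integrable G := by
    have hmem := memLp_id_gaussianReal (μ := 0) (v := v) 2
    have hint2 : Integrable (fun t : ℝ => t ^ 2) (gaussianReal 0 v) := by
      have := hmem.integrable_sq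
      simpa using this
    rw [gaussianReal_of_var_ne_zero _ hv0, integrable_withDensity_iff (measurable_gaussianPDF _ _)
      (Eventually.of_forall fun _ => gaussianPDF_lt_top)] at hint2
    simp only [toReal_gaussianPDF] at hint2
    have h0 : Integrable fun t : ℝ => (2 + |s|) * gaussianPDFReal 0 v t :=
      (integrable_gaussianPDFReal 0 v).const_mul _
    exact (h0.add hint2).congr (Eventually.of_forall fun t => by simp only [hG, Pi.add_apply]; ring)
  have hGval : ∫ t, G t = 2 + |s| + β⁻¹ := by
    have e1 : (fun t => G t) = fun t => (2 + |s|) * gaussianPDFReal 0 v t + gaussianPDFReal 0 v t * t ^ 2 := by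
      funext t; simp only [hG]; ring
    have hint2' : Integrable fun t : ℝ => gaussianPDFReal 0 v t * t ^ 2 := by
      have := hGi.sub ((integrable_gaussianPDFReal 0 v).const_mul (2 + |s|))
      exact this.congr (Eventually.of_forall fun t => by simp only [hG, Pi.sub_apply]; ring)
    rw [e1, integral_add ((integrable_gaussianPDFReal 0 v).const_mul _) hint2', integral_const_mul,
      integral_gaussianPDFReal_eq_one 0 hv0, mul_one]
    congr 1
    -- second moment `= variance = β⁻¹`
    have hvar := variance_id_gaussianReal (μ := 0) (v := v)
    rw [variance_eq_integral measurable_id.aemeasurable] at hvar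
    simp only [id_eq, integral_id_gaussianReal, sub_zero] at hvar
    rw [integral_gaussianReal_eq_integral_smul hv0] at hvar
    simp only [smul_eq_mul] at hvar
    rw [hvar, hvr]
  calc ∫⁻ r in Ioi (0 : ℝ), ENNReal.ofReal ((1 + r) * gaussianPDFReal 0 v (r + s))
      ≤ ∫⁻ r in Ioi (0 : ℝ), ENNReal.ofReal (G (r + s)) := setLIntegral_mono' measurableSet_Ioi hpt
    _ ≤ ∫⁻ r, ENNReal.ofReal (G (r + s)) := setLIntegral_le_lintegral _ _
    _ = ∫⁻ t, ENNReal.ofReal (G t) := lintegral_add_right_eq_self (fun t => ENNReal.ofReal (G t)) s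
    _ = ENNReal.ofReal (∫ t, G t) := (ofReal_integral_eq_lintegral_ofReal hGi (Eventually.of_forall hG0)).symm
    _ = ENNReal.ofReal (2 + |s| + β⁻¹) := by rw [hGval]

/-! ## The uniform mixed moment -/

/-- The radial integrand of `I_θ(v)`: for `r > 0`, `|ν| = 1`, `s = ⟪v, ν⟫` and `γ = 1 - θ(d - 2)`,
`r^{d-1} k_β(v, rν) k_β(v + rν, -rν)^θ = r^γ p_β(r + s) p_β(s)^θ`. [folklore] -/
theorem radial_carlemanKernel_mul_rpow (hd : 2 ≤ Fintype.card d) (θ : ℝ)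
    (v : EuclideanSpace ℝ d) (ν : sphere (0 : EuclideanSpace ℝ d) 1) {r : ℝ} (hr : 0 < r) :
    r ^ (Fintype.card d - 1) * (carlemanKernel β v (r • (ν : EuclideanSpace ℝ d)) *
        carlemanKernel β (v + r • (ν : EuclideanSpace ℝ d)) (-(r • (ν : EuclideanSpace ℝ d))) ^ θ) =
      r ^ (1 - θ * (Fintype.card d - 2 : ℕ)) * (gaussianPDFReal 0 (β⁻¹).toNNReal (r + ⟪v, (ν : EuclideanSpace ℝ d)⟫_ℝ) *
        gaussianPDFReal 0 (β⁻¹).toNNReal ⟪v, (ν : EuclideanSpace ℝ d)⟫_ℝ ^ θ) := by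
  obtain ⟨h1, h2⟩ := carlemanKernel_smul_sphere β v ν hr
  rw [h1, h2]
  set m : ℕ := Fintype.card d - 2 with hm
  have hdm : Fintype.card d - 1 = m + 1 := by omega
  set p₁ := gaussianPDFReal 0 (β⁻¹).toNNReal (r + ⟪v, (ν : EuclideanSpace ℝ d)⟫_ℝ)
  set p₀ := gaussianPDFReal 0 (β⁻¹).toNNReal ⟪v, (ν : EuclideanSpace ℝ d)⟫_ℝ
  have hp₀ : 0 ≤ p₀ := gaussianPDFReal_nonneg _ _ _
  have hrm : 0 < r ^ m := pow_pos hr m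
  rw [hdm, Real.mul_rpow (inv_nonneg.2 hrm.le) hp₀, Real.inv_rpow hrm.le, ← Real.rpow_natCast r m,
    ← Real.rpow_mul hr.le]
  -- `r^{m+1} (r^m)⁻¹ p₁ ((r^{mθ})⁻¹ p₀^θ) = r^{1 - θ m} p₁ p₀^θ`
  have e : r ^ (1 - θ * (m : ℕ)) = r ^ (m + 1) * (r ^ (m : ℝ))⁻¹ * (r ^ ((m : ℝ) * θ))⁻¹ := by
    rw [← Real.rpow_natCast r (m + 1), ← Real.rpow_neg hr.le, ← Real.rpow_neg hr.le,
      ← Real.rpow_add hr, ← Real.rpow_add hr]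
    congr 1
    push_cast
    ring
  rw [Real.rpow_natCast r m] at e ⊢
  rw [e]
  ring

/-- `r^γ ≤ 1 + r` for `r ≥ 0` and `γ ∈ [0, 1]`. [folklore] -/
theorem rpow_le_one_add {r γ : ℝ} (hr : 0 ≤ r) (hγ0 : 0 ≤ γ) (hγ1 : γ ≤ 1) : r ^ γ ≤ 1 + r := by
  rcases le_or_gt r 1 with h | h
  · exact (Real.rpow_le_one hr h hγ0).trans (by linarith)
  · calc r ^ γ ≤ r ^ (1 : ℝ) := Real.rpow_le_rpow_of_exponent_le h.le hγ1
      _ = r := Real.rpow_one r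
      _ ≤ 1 + r := by linarith

/-- The radial integral of `I_θ(v)` in a fixed direction is bounded by the one-dimensional
constant: `∫₀^∞ r^{d-1} k_β(v, rν) k_β(v + rν, -rν)^θ dr ≤ C₁` whenever
`p_β(s)^θ (2 + β⁻¹ + |s|) ≤ C₁` on `ℝ`. [folklore] -/
theorem lintegral_radial_carlemanKernel_mul_rpow_le (hd : 2 ≤ Fintype.card d) (hβ : 0 < β)
    {θ : ℝ} (hθ : 0 < θ) (hθd : θ * (Fintype.card d - 2 : ℕ) ≤ 1) {C₁ : ℝ}
    (hC₁ : ∀ s : ℝ, gaussianPDFReal 0 (β⁻¹).toNNReal s ^ θ * (2 + β⁻¹ + |s|) ≤ C₁)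
    (v : EuclideanSpace ℝ d) (ν : sphere (0 : EuclideanSpace ℝ d) 1) :
    ∫⁻ r in Ioi (0 : ℝ), ENNReal.ofReal (r ^ (Fintype.card d - 1)) *
        ENNReal.ofReal (carlemanKernel β v (r • (ν : EuclideanSpace ℝ d)) *
          carlemanKernel β (v + r • (ν : EuclideanSpace ℝ d)) (-(r • (ν : EuclideanSpace ℝ d))) ^ θ) ≤
      ENNReal.ofReal C₁ := by
  have hγ0 : 0 ≤ 1 - θ * (Fintype.card d - 2 : ℕ) := by linarith
  have hγ1 : 1 - θ * (Fintype.card d - 2 : ℕ) ≤ 1 := by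
    have : 0 ≤ θ * (Fintype.card d - 2 : ℕ) := by positivity
    linarith
  have hps : 0 ≤ gaussianPDFReal 0 (β⁻¹).toNNReal ⟪v, (ν : EuclideanSpace ℝ d)⟫_ℝ ^ θ :=
    Real.rpow_nonneg (gaussianPDFReal_nonneg _ _ _) _
  -- pointwise bound of the radial integrand
  have hpt : ∀ r ∈ Ioi (0 : ℝ), ENNReal.ofReal (r ^ (Fintype.card d - 1)) *
      ENNReal.ofReal (carlemanKernel β v (r • (ν : EuclideanSpace ℝ d)) *
        carlemanKernel β (v + r • (ν : EuclideanSpace ℝ d)) (-(r • (ν : EuclideanSpace ℝ d))) ^ θ) ≤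
      ENNReal.ofReal ((1 + r) * gaussianPDFReal 0 (β⁻¹).toNNReal (r + ⟪v, (ν : EuclideanSpace ℝ d)⟫_ℝ)) *
        ENNReal.ofReal (gaussianPDFReal 0 (β⁻¹).toNNReal ⟪v, (ν : EuclideanSpace ℝ d)⟫_ℝ ^ θ) := by
    intro r hr
    have hr0 : (0 : ℝ) < r := hr
    have hp1 : 0 ≤ gaussianPDFReal 0 (β⁻¹).toNNReal (r + ⟪v, (ν : EuclideanSpace ℝ d)⟫_ℝ) :=
      gaussianPDFReal_nonneg _ _ _
    rw [← ENNReal.ofReal_mul (pow_nonneg hr0.le _), radial_carlemanKernel_mul_rpow hd θ v ν hr0,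
      ← ENNReal.ofReal_mul (mul_nonneg (by linarith) hp1)]
    refine ENNReal.ofReal_le_ofReal ?_
    rw [mul_assoc]
    exact mul_le_mul_of_nonneg_right (rpow_le_one_add hr0.le hγ0 hγ1) (mul_nonneg hp1 hps)
  have hmeas : Measurable fun r : ℝ => ENNReal.ofReal ((1 + r) *
      gaussianPDFReal 0 (β⁻¹).toNNReal (r + ⟪v, (ν : EuclideanSpace ℝ d)⟫_ℝ)) :=
    ((measurable_const.add measurable_id).mul
      ((measurable_gaussianPDFReal _ _).comp (measurable_id.add measurable_const))).ennreal_ofReal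
  calc ∫⁻ r in Ioi (0 : ℝ), ENNReal.ofReal (r ^ (Fintype.card d - 1)) *
        ENNReal.ofReal (carlemanKernel β v (r • (ν : EuclideanSpace ℝ d)) *
          carlemanKernel β (v + r • (ν : EuclideanSpace ℝ d)) (-(r • (ν : EuclideanSpace ℝ d))) ^ θ)
      ≤ ∫⁻ r in Ioi (0 : ℝ), ENNReal.ofReal ((1 + r) *
          gaussianPDFReal 0 (β⁻¹).toNNReal (r + ⟪v, (ν : EuclideanSpace ℝ d)⟫_ℝ)) *
          ENNReal.ofReal (gaussianPDFReal 0 (β⁻¹).toNNReal ⟪v, (ν : EuclideanSpace ℝ d)⟫_ℝ ^ θ) :=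
        setLIntegral_mono' measurableSet_Ioi hpt
    _ = (∫⁻ r in Ioi (0 : ℝ), ENNReal.ofReal ((1 + r) *
          gaussianPDFReal 0 (β⁻¹).toNNReal (r + ⟪v, (ν : EuclideanSpace ℝ d)⟫_ℝ))) *
          ENNReal.ofReal (gaussianPDFReal 0 (β⁻¹).toNNReal ⟪v, (ν : EuclideanSpace ℝ d)⟫_ℝ ^ θ) :=
        lintegral_mul_const _ hmeas
    _ ≤ ENNReal.ofReal (2 + |⟪v, (ν : EuclideanSpace ℝ d)⟫_ℝ| + β⁻¹) *
          ENNReal.ofReal (gaussianPDFReal 0 (β⁻¹).toNNReal ⟪v, (ν : EuclideanSpace ℝ d)⟫_ℝ ^ θ) :=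
        mul_le_mul' (lintegral_Ioi_one_add_mul_gaussianPDFReal_le hβ _) le_rfl
    _ = ENNReal.ofReal (gaussianPDFReal 0 (β⁻¹).toNNReal ⟪v, (ν : EuclideanSpace ℝ d)⟫_ℝ ^ θ *
          (2 + β⁻¹ + |⟪v, (ν : EuclideanSpace ℝ d)⟫_ℝ|)) := by
        rw [← ENNReal.ofReal_mul (by positivity)]
        congr 1
        ring
    _ ≤ ENNReal.ofReal C₁ := ENNReal.ofReal_le_ofReal (hC₁ _)

/-- **Uniform bound for the mixed moment of the Carleman kernel**: for `d ≥ 2`, `β > 0` and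
`0 < θ` with `θ (d - 2) ≤ 1` there is `C < ∞` with
`I_θ(v) = ∫ k_β(v, u) k_β(v + u, -u)^θ du ≤ C` for every `v ∈ ℝ^d`. In polar coordinates the
integrand is `r^γ p_β(r + ⟪v, ν⟫) p_β(⟪v, ν⟫)^θ` with `γ = 1 - θ(d - 2) ∈ [0, 1]`, `r^γ ≤ 1 + r`,
`∫₀^∞ (1 + r) p_β(r + s) dr ≤ 2 + |s| + β⁻¹`, and `p_β(s)^θ (2 + β⁻¹ + |s|)` is bounded.
(Used with `ρ_v(u) = k_β(v + u, -u)/M_β(v)`, detailed balance, to pass from `L¹(M_β)`-smallness of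
`h` to pointwise smallness of `K⁺_β |h|`.) [cite: BodineauGallagherSaintRaymondInvent2016, §6.1.2–6.1.3] -/
theorem exists_lintegral_carlemanKernel_mul_rpow_le (hd : 2 ≤ Fintype.card d) (hβ : 0 < β)
    {θ : ℝ} (hθ : 0 < θ) (hθd : θ * (Fintype.card d - 2 : ℕ) ≤ 1) :
    ∃ C : ℝ≥0∞, C < ∞ ∧ ∀ v : EuclideanSpace ℝ d,
      ∫⁻ u, ENNReal.ofReal (carlemanKernel β v u * carlemanKernel β (v + u) (-u) ^ θ) ≤ C := by
  obtain ⟨C₁, -, hC₁⟩ := exists_bound_gaussianPDFReal_rpow_mul hβ hθ (A := 2 + β⁻¹) (by positivity)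
  refine ⟨ENNReal.ofReal C₁ * (sphereMeasure : Measure (sphere (0 : EuclideanSpace ℝ d) 1)) univ,
    ENNReal.mul_lt_top ENNReal.ofReal_lt_top IsFiniteMeasure.measure_univ_lt_top, fun v => ?_⟩
  have hHm : Measurable fun u : EuclideanSpace ℝ d =>
      ENNReal.ofReal (carlemanKernel β v u * carlemanKernel β (v + u) (-u) ^ θ) := by
    refine ((measurable_carlemanKernel_right β v).mul ?_).ennreal_ofReal
    exact ((measurable_carlemanKernel β).comp ((measurable_const_add v).prodMk measurable_neg)).pow_const θ
  calc ∫⁻ u, ENNReal.ofReal (carlemanKernel β v u * carlemanKernel β (v + u) (-u) ^ θ)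
      = ∫⁻ ν : sphere (0 : EuclideanSpace ℝ d) 1, (∫⁻ r in Ioi (0 : ℝ), ENNReal.ofReal (r ^ (Fintype.card d - 1)) *
          ENNReal.ofReal (carlemanKernel β v (r • (ν : EuclideanSpace ℝ d)) *
            carlemanKernel β (v + r • (ν : EuclideanSpace ℝ d)) (-(r • (ν : EuclideanSpace ℝ d))) ^ θ))
          ∂(sphereMeasure : Measure (sphere (0 : EuclideanSpace ℝ d) 1)) :=
        lintegral_eq_lintegral_sphere_radial hd hHm
    _ ≤ ∫⁻ _ν : sphere (0 : EuclideanSpace ℝ d) 1, ENNReal.ofReal C₁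
          ∂(sphereMeasure : Measure (sphere (0 : EuclideanSpace ℝ d) 1)) :=
        lintegral_mono fun ν => lintegral_radial_carlemanKernel_mul_rpow_le hd hβ hθ hθd hC₁ v ν
    _ = ENNReal.ofReal C₁ * (sphereMeasure : Measure (sphere (0 : EuclideanSpace ℝ d) 1)) univ :=
        lintegral_const _

end

end Literature.MathematicalPhysics.KineticTheory
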